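import Summits.QuantumFields.YangMills.Theorems.BalabanUVNodesN15TwoGridBackgroundSupCarrier
import Summits.QuantumFields.YangMills.Theorems.BalabanUVNodesN15FullPropagatorSizedN15At
import HarnessLib

/-!
# N15 (NE2) — PROGRAMME M «MEAN-ZERO MULTIPLIERS», part M-F: ★★★ `NE2PlusOperator` BY NAME, HYPOTHESIS-FREE, FOR BAŁABAN's FULL PAIR `(Δ′_a⁻¹, Δ_a⁻¹)` DRESSED BY THE
# ZEROTH-ORDER BACKGROUND SPECIES ON THE SUP-ONLY CARRIER — the background block LIVE through entry 0, (3.35) = its sup letter ONLY, the size guard LIVE, every letter a tree theorem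

WHO ∕ WHEN.  Cell `pub-ymgap`, seat `pub-ymgap-dag-n15-a` (KNIT-BY-NAME seat of Track-A DAG node N15 = NE2, g24); `--kind proof --supports stmt-QuantumFields-27366 --as helper` (K3⁸;
count-neutral).  Over part M-E `…TwoGridBackgroundSupCarrier` (`bgInstanceSup`, `bgFamilySup`, ★★★ `ne2PlusOperator_supOnly`), part S-A `…FullPropagatorSizedN15At` (`TGIndexS`,
`tgIndexS_cofinal`; through it parts 52∕54∕59∕71∕72: `hasMaj_twoGridDefect`, `hasMaj_twoGridDefect_lap`, `tgT1`∕`hasMaj_tgT1`, `tgT2`∕`hasMaj_tgT2`, `hasMaj_rescale`) and part 36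
(`ineq110_114_pair`, `hasMaj_gOp_of_ineq`, `hasMaj_gDivAdj_of_ineq`) BY NAME; nothing in the tree is modified.
WHY.  M-E states the node's first conjunct over the sup-only carrier for ANY family of King-torus data with uniform `U ≡ 1` letters.  THIS FILE instantiates it at BAŁABAN's FULL `U ≡ 1`
PAIR on the torus family of record, sized index `TGIndexS` (`(m_T, k ≥ 1, m, M_sz ≥ 1)`): every `U ≡ 1` letter is a tree theorem, so `NE2PlusOperator` holds with NO displayed binder and
NO oscillation letter on the background — the background enters entry 0 GENUINELY (the dressed pair `X′(c′) = (1 − G′M_{c′})⁻¹G′`, `X(blockAvg c′)`), entries 1–3 are the pair's own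
`U ≡ 1` η-defects `tgT1`, `tgT2`, `𝔇(ΔG)` (U-blind — located: their dressed versions need the mixed letter «∇G∇*»).
WHAT.  §13 `supT` (entries 1–3: `tgT1`, `tgT2`, the entry-3 defect operator of parts 54∕72), `supInstanceFG` ∕ `supFamilyFG` (M-E's instance ∕ family at the index's torus, runs and size,
`G := Δ_a⁻¹`, `G′ := Δ′_a⁻¹`), `supInstanceFG_gf_M` (the guard reads `M_sz`; cofinal by `tgIndexS_cofinal`), ★★★ **`ne2PlusOperator_supOnly_fullG`**: for odd `L ≥ 3`, `a > 0`, `c₃₅ > 0`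
and directions `ν, μ`: `NE2PlusOperator c₃₅ (supInstanceFG d hL) (supFamilyFG d hL a ν μ)` — HYPOTHESIS-FREE; ★★ `ne2ZeroOperator_supOnly_fullG` (`T4EtaRate.ne2Zero_of_ne2Plus`).
HONEST FRAMING ∕ LIMITS.  Composition of LANDED theorems on the `U ≡ 1` torus MODEL carriers of the lineage; the background species is the scalar ZEROTH-order multiplier (linearised transport
(C3)), live in entry 0 only; entries 1–3 U-blind; `NE2PlusOperator` is the tree's HYPOTHESIS SHAPE, not [B9]'s printed statement (no `Q(U)`, abelianised `V′`); nothing of [B5]∕[B6]∕[B9]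
asserted beyond the cited landed rows; NE2⁺ AS PRINTED NOT proved; no statement of record touched; N15 NOT discharged; K3⁸ OPEN; counts UNMOVED (typed 28∕28 · discharged 5∕27); every index
a finite torus at fixed spacings — NOT infinite volume ∕ OS ∕ mass gap ∕ Clay.
-/

noncomputable section

open scoped BigOperators
open Finset

namespace Summit.QuantumFields.YangMills.BalabanUVNodes.N15.TwoGrid

open Literature.MathematicalPhysics.QuantumFieldTheory.Balaban1983to89
open Literature.MathematicalPhysics.QuantumFieldTheory.Balaban1983to89.B11SectG (BlockNorm HasMaj)
open Literature.MathematicalPhysics.QuantumFieldTheory.Balaban1983to89.T4EtaRate (PairedInstance NE2PlusOperator NE2ZeroOperator ne2Zero_of_ne2Plus)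
open Literature.MathematicalPhysics.QuantumFieldTheory.Balaban1983to89.T4EtaRateDefect (idef)
open Literature.MathematicalPhysics.QuantumFieldTheory.Balaban1983to89.T4EtaRateCoeffDefect (pull)
open Literature.MathematicalPhysics.QuantumFieldTheory.Balaban1983to89.B5Prop11Plancherel (Tor fine)
open Literature.MathematicalPhysics.QuantumFieldTheory.Balaban1983to89.B5SiteBridgeP12 (MP)
open Literature.MathematicalPhysics.QuantumFieldTheory.King1986.Torus (blockOf tdistT tdistT_nonneg)
open Literature.MathematicalPhysics.QuantumFieldTheory.Balaban1983to89.B6UnitTorusCarrier (unitTorusGeo rowSum_unitTorusGeo)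
open Summit.QuantumFields.YangMills.BalabanUVNodes.N15.VectorPiece (blkFine kingPrV)
open Summit.QuantumFields.YangMills.BalabanUVNodes.N15.GenuineRecord (TGIndexS tgIndexS_cofinal)

variable (d : ℕ) {L : ℕ} [NeZero L]

/-! ## §13 The instance at Bałaban's full pair on the torus family of record; ★★★ `NE2PlusOperator` hypothesis-free -/

/-- ENTRIES 1–3 of the family: the `U ≡ 1` pair's own η-defects `𝔇(∇_νG)` (`tgT1`, part 59), `𝔇(G∇*_μ)` (`tgT2`, part 71), `𝔇(ΔG)` (parts 54∕72) at the index's torus — U-blind (located).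
[cite: Balaban1985BackgroundPropagators, (3.42) p.397 (entries ∇G, G∇*, ΔG: shape)] -/
def supT (hL : Odd L ∧ 1 < L) (a : ℝ) (ν μ : Fin (d + 1)) (j : TGIndexS) :
    Fin 3 → (Tor (fine (L ^ j.m * L ^ j.k) (TGIndex.Mn d hL j.toTGIndex)) × Fin (d + 1) → ℝ) →
      ((Tor (fine (L ^ j.k) (TGIndex.Mn d hL j.toTGIndex)) × Fin (d + 1) → ℝ) →ₗ[ℝ] (Tor (fine (L ^ j.m * L ^ j.k) (TGIndex.Mn d hL j.toTGIndex)) × Fin (d + 1) → ℝ)) :=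
  fun n _ => ![tgT1 d hL a ν j.toTGIndex, tgT2 d hL a μ j.toTGIndex,
    idef (pull (kingPrV L j.k j.m (TGIndex.Mn d hL j.toTGIndex))) (pull (kingPrV L j.k j.m (TGIndex.Mn d hL j.toTGIndex)))
      (symbOp (TGIndex.Mn d hL j.toTGIndex) (L ^ j.m * L ^ j.k) (sLap (TGIndex.Mn d hL j.toTGIndex) (L ^ j.m * L ^ j.k) ((L ^ j.m * L ^ j.k : ℕ) : ℝ)) ∘ₗ
        gOp (TGIndex.Mn d hL j.toTGIndex) (L ^ j.m * L ^ j.k) a)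
      (symbOp (TGIndex.Mn d hL j.toTGIndex) (L ^ j.k) (sLap (TGIndex.Mn d hL j.toTGIndex) (L ^ j.k) ((L ^ j.k : ℕ) : ℝ)) ∘ₗ gOp (TGIndex.Mn d hL j.toTGIndex) (L ^ j.k) a)] n

/-- THE REALISED PAIRED INSTANCE at a sized index: M-E's `bgInstanceSup` at the index's torus `M_ν = 2L^{m_T}`, runs `k`, `k + m`, size `M_sz` — sup-only coefficient carriers.
[cite: Balaban1985BackgroundPropagators, Thm 3.14 pp.426–427 (typing template)] -/
def supInstanceFG (hL : Odd L ∧ 1 < L) (j : TGIndexS) : PairedInstance := bgInstanceSup (L := L) (TGIndex.Mn d hL j.toTGIndex) j.k j.m j.Msz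

/-- THE GUARD IS LIVE: `(gf j).M = M_sz` — and the index family is cofinal in `M_sz` (`tgIndexS_cofinal`). [folklore] -/
theorem supInstanceFG_gf_M (hL : Odd L ∧ 1 < L) (j : TGIndexS) : (supInstanceFG d hL j).gf.M = j.Msz := rfl

/-- For every `M₅` and `k₀` there is an index with `M₅ ≤ (gf j).M` and `k₀ ≤ k`: the size guard excludes nothing uniformly. [folklore] -/
theorem supInstanceFG_cofinal (hL : Odd L ∧ 1 < L) (M₅ : ℝ) (k₀ : ℕ) : ∃ j : TGIndexS, M₅ ≤ (supInstanceFG d hL j).gf.M ∧ k₀ ≤ j.k := tgIndexS_cofinal M₅ k₀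

/-- THE KERNEL FAMILY at a sized index: M-E's `bgFamilySup` with `G := Δ_a⁻¹` (spacing `L^{−k}`), `G′ := Δ′_a⁻¹` (spacing `L^{−(m+k)}`) — entry 0 = the η-defect of the ZEROTH-ORDER-DRESSED pair
`(X′(c′), X(blockAvg c′))`, background LIVE — and entries 1–3 = `supT`. [cite: Balaban1985BackgroundPropagators, (3.42) p.397 (the four entries: shape), (3.62)–(3.65) pp.402–403 (mechanism)] -/
def supFamilyFG (hL : Odd L ∧ 1 < L) (a : ℝ) (ν μ : Fin (d + 1)) (j : TGIndexS) : B9.KernelFamily (supInstanceFG d hL j).gc (supInstanceFG d hL j).Bf :=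
  bgFamilySup (L := L) (TGIndex.Mn d hL j.toTGIndex) j.k j.m j.Msz (gOp (TGIndex.Mn d hL j.toTGIndex) (L ^ j.k) a) (gOp (TGIndex.Mn d hL j.toTGIndex) (L ^ j.m * L ^ j.k) a)
    (supT d hL a ν μ j)

/-- ★★★ **NE2⁺, OPERATOR LAYER — `T4EtaRate.NE2PlusOperator` BY NAME, HYPOTHESIS-FREE, FOR BAŁABAN's FULL PAIR DRESSED BY THE ZEROTH-ORDER SPECIES ON THE SUP-ONLY CARRIER.**  For odd
`L ≥ 3`, `a > 0`, `c₃₅ > 0` and directions `ν, μ`: `NE2PlusOperator c₃₅ (supInstanceFG d hL) (supFamilyFG d hL a ν μ)`.  (3.35) is consumed as its SUP LETTER ONLY (no oscillation ∕ gradient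
letter on the background), the size guard `M₅ ≤ M_sz` is LIVE (cofinal family), the guard `M_sz·α₀ ≤ a₀` drives the Neumann contraction, entry 0 carries the background GENUINELY, and every
`U ≡ 1` letter is a tree theorem: (1.110) entries 0∕2 on both grids (`ineq110_114_pair`), the η-defects `hasMaj_twoGridDefect` (entry 0, `γ = 2γ₀`), `hasMaj_tgT1`, `hasMaj_tgT2`,
`hasMaj_twoGridDefect_lap` (entries 1–3), common rate number `θ_j = (L^k)^{−γ₀}`, `γ₀ = min(1∕16, 1∕(8(d+1)))`. [cite: Balaban1985BackgroundPropagators, Thm 3.1 p.397 (quantifier template),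
(3.35) p.396, (3.42) p.397, (3.62)–(3.65) pp.402–403 (shapes, mechanism); Balaban1984PropagatorsI, Prop. 1.2 (1.110) p.35; King1986, Prop. 3.9 (3.73) p.665 (rate factor)] -/
theorem ne2PlusOperator_supOnly_fullG (hLodd : Odd L) (hL3 : 3 ≤ L) (hL : Odd L ∧ 1 < L) {a : ℝ} (ha : 0 < a) (c35 : ℝ) (hc35 : 0 < c35) (ν μ : Fin (d + 1)) :
    NE2PlusOperator c35 (supInstanceFG d hL) (supFamilyFG d hL a ν μ) := by
  have hL2 : 2 ≤ L := by omega
  have hL1 : (1 : ℝ) ≤ (L : ℝ) := by exact_mod_cast (show 1 ≤ L by omega)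
  have hLr : (0 : ℝ) < (L : ℝ) := by positivity
  -- the common rate exponent
  set γ₀ : ℝ := min (1 / 16) (1 / (8 * ((d : ℝ) + 1))) with hγ₀def
  have hd8 : (0 : ℝ) < 1 / (8 * ((d : ℝ) + 1)) := by positivity
  have hγ₀ : 0 < γ₀ := lt_min (by norm_num) hd8
  have hγ₀le : γ₀ ≤ 1 / 16 := min_le_left _ _
  -- the `U ≡ 1` letters of record
  obtain ⟨δ₀, C, Cα, Cε, Cαε, hδ₀, hC, H110⟩ := ineq110_114_pair (d := d) hL ha
  obtain ⟨δ₁, D, hδ₁, hD, HDef⟩ := hasMaj_twoGridDefect (d := d) hLodd hL2 ha (γ := 2 * γ₀) (by positivity) (by linarith)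
  obtain ⟨δ₂, C₁', hδ₂, hC₁', H1⟩ := hasMaj_tgT1 (d := d) hLodd hL2 hL ha ν
  obtain ⟨δ₃, C₂', hδ₃, hC₂', H2⟩ := hasMaj_tgT2 (d := d) hLodd hL2 hL ha μ
  obtain ⟨δ₄, C₃', hδ₄, hC₃', H3⟩ := hasMaj_twoGridDefect_lap (d := d) hLodd hL2 ha (γ := 2 * γ₀) (by positivity) (by linarith)
  set δ : ℝ := min δ₀ δ₁ with hδdef
  have hδ : 0 < δ := lt_min hδ₀ hδ₁
  set ρ₃ : ℝ := min δ₂ (min δ₃ δ₄) with hρ₃def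
  have hρ₃ : 0 < ρ₃ := lt_min hδ₂ (lt_min hδ₃ hδ₄)
  set B₃ : ℝ := max C₁' (max C₂' C₃') with hB₃def
  have hB₃ : 0 ≤ B₃ := hC₁'.le.trans (le_max_left _ _)
  have hσ : 0 < δ / 2 := by positivity
  -- rate monotonicity at one index
  have hmono : ∀ (j : TGIndexS) {F₁ F₂ : Type} [AddCommGroup F₁] [Module ℝ F₁] [AddCommGroup F₂] [Module ℝ F₂]
      {b₁ : BlockNorm (unitTorusGeo L j.k (TGIndex.Mn d hL j.toTGIndex)) F₁} {b₂ : BlockNorm (unitTorusGeo L j.k (TGIndex.Mn d hL j.toTGIndex)) F₂} {T : F₁ →ₗ[ℝ] F₂} {A t : ℝ},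
      0 ≤ A → δ ≤ t → HasMaj b₁ b₂ T (fun y y' => A * Real.exp (-(t * tdistT (TGIndex.Mn d hL j.toTGIndex) y y'))) →
      HasMaj b₁ b₂ T (fun y y' => A * Real.exp (-(δ * tdistT (TGIndex.Mn d hL j.toTGIndex) y y'))) :=
    fun j _ _ _ _ _ _ _ _ _ _ _ hA ht h => h.mono fun y y' => mul_le_mul_of_nonneg_left (Real.exp_le_exp.mpr (by nlinarith [tdistT_nonneg (TGIndex.Mn d hL j.toTGIndex) y y'])) hA
  refine ne2PlusOperator_supOnly (L := L) (fun j : TGIndexS => TGIndex.Mn d hL j.toTGIndex) (fun j => j.k) (fun j => j.m) (fun j => j.Msz) (fun j => ((L : ℝ) ^ j.k) ^ (-γ₀))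
    (fun j => gOp (TGIndex.Mn d hL j.toTGIndex) (L ^ j.k) a) (fun j => gOp (TGIndex.Mn d hL j.toTGIndex) (L ^ j.m * L ^ j.k) a) (fun j => supT d hL a ν μ j)
    c35 hc35 hσ.le (B4Sect5Proof.latticeConst_nonneg (d + 1) hσ.le) (fun j => rowSum_unitTorusGeo L j.k _ hσ) (δ := δ) (β := C) (m₀ := D) (γ := γ₀) (C₁ := C) (B₃ := B₃) (ρ₃ := ρ₃)
    (by linarith) hC.le hD.le hγ₀ hC.le hB₃ hρ₃ (fun j => Real.rpow_nonneg (pow_nonneg hLr.le _) _) (fun j => ?_) (fun j => le_rfl) (fun j => ?_) (fun j => ?_) (fun j => ?_)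
    (fun j κ => ?_) (fun j c' n => ?_)
  · -- `(L^k)⁻¹ ≤ (L^k)^{−γ₀}`
    have hx1 : (1 : ℝ) ≤ (L : ℝ) ^ j.k := one_le_pow₀ hL1
    have hcast : (((L ^ j.k : ℕ) : ℝ))⁻¹ = ((L : ℝ) ^ j.k) ^ (-(1 : ℝ)) := by rw [Real.rpow_neg_one]; push_cast; ring
    rw [hcast]
    exact Real.rpow_le_rpow_of_exponent_le hx1 (by linarith)
  · -- entry 0 coarse piece (1.110)
    obtain ⟨Hc, _⟩ := H110 j.mT j.k j.m j.one_le
    exact hmono j hC.le (min_le_left _ _) (hasMaj_gOp_of_ineq (TGIndex.Mn d hL j.toTGIndex) j.k (L ^ j.k) a (Nat.one_le_pow _ _ (by omega)) Hc hC.le)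
  · obtain ⟨_, Hf⟩ := H110 j.mT j.k j.m j.one_le
    exact hmono j hC.le (min_le_left _ _) (hasMaj_gOp_of_ineq (TGIndex.Mn d hL j.toTGIndex) j.k (L ^ j.m * L ^ j.k) a (Nat.one_le_iff_ne_zero.mpr (NeZero.ne _)) Hf hC.le)
  · -- the `U ≡ 1` η-defect at `γ = 2γ₀`: rate `(L^k)^{−γ₀}`
    have hcast : ((L ^ j.k : ℕ) : ℝ) = (L : ℝ) ^ j.k := by push_cast; ring
    have hq : (-(2 * γ₀ / 2)) = -γ₀ := by ring
    have hDk : 0 ≤ D * ((L : ℝ) ^ j.k) ^ (-γ₀) := mul_nonneg hD.le (Real.rpow_nonneg (pow_nonneg hLr.le _) _)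
    have e0 := (HDef j.mT j.k j.m j.one_le hL).mono (K' := fun y y' => D * ((L : ℝ) ^ j.k) ^ (-γ₀) * Real.exp (-(δ₁ * tdistT (MP (paramsOf d L j.mT j.k hL)) y y')))
      fun y y' => by rw [hcast, hq]
    exact hmono j hDk (min_le_right _ _) e0
  · obtain ⟨_, Hf⟩ := H110 j.mT j.k j.m j.one_le
    exact hmono j hC.le (min_le_left _ _) (hasMaj_gDivAdj_of_ineq (TGIndex.Mn d hL j.toTGIndex) j.k (L ^ j.m * L ^ j.k) a (Nat.one_le_iff_ne_zero.mpr (NeZero.ne _)) Hf hC.le κ)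
  · -- entries 1–3, rescaled to `(B₃, γ₀, ρ₃)`
    have hγ₁ : γ₀ ≤ 1 / 16 := hγ₀le
    have hγ₂ : γ₀ ≤ 1 / (8 * ((d : ℝ) + 1)) := min_le_right _ _
    have hγ₃ : γ₀ ≤ 2 * γ₀ / 2 := by linarith
    fin_cases n
    · exact hasMaj_rescale hL1 hB₃ (le_max_left _ _) hγ₁ (min_le_left _ _) (H1 j.toTGIndex)
    · exact hasMaj_rescale hL1 hB₃ ((le_max_left _ _).trans (le_max_right _ _)) hγ₂ ((min_le_right _ _).trans (min_le_left _ _)) (H2 j.toTGIndex)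
    · have hcast : ((L ^ j.k : ℕ) : ℝ) = (L : ℝ) ^ j.k := by push_cast; ring
      have e3 := (H3 j.mT j.k j.m j.one_le hL).mono
        (K' := fun y y' => C₃' * ((L : ℝ) ^ j.k) ^ (-(2 * γ₀ / 2)) * Real.exp (-(δ₄ * tdistT (MP (paramsOf d L j.mT j.k hL)) y y'))) fun y y' => by rw [hcast]
      exact hasMaj_rescale hL1 hB₃ ((le_max_right _ _).trans (le_max_right _ _)) hγ₃ ((min_le_right _ _).trans (min_le_right _ _)) e3

/-- ★★ **NE2⁰ FOR THE SAME FAMILY — `T4EtaRate.NE2ZeroOperator` BY NAME**: at the trivial configuration (`c′ = 0`, regular for every `α₀ > 0` since `c₃₅·M_sz·α₀ ≥ 0` under the guard `M_sz ≥ 1`)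
the family obeys `EtaRateIneq342` with the size guard live — `T4EtaRate.ne2Zero_of_ne2Plus`. [cite: King1986, Props. 3.8–3.9 (3.71)–(3.75) pp.664–665 (A = 0 model); Balaban1985BackgroundPropagators,
Thm 3.1 p.397 (quantifier template)] -/
theorem ne2ZeroOperator_supOnly_fullG (hLodd : Odd L) (hL3 : 3 ≤ L) (hL : Odd L ∧ 1 < L) {a : ℝ} (ha : 0 < a) {c35 : ℝ} (hc35 : 0 < c35) (ν μ : Fin (d + 1)) :
    NE2ZeroOperator (supInstanceFG d hL) (supFamilyFG d hL a ν μ) := by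
  refine ne2Zero_of_ne2Plus (c35 := c35) (fun j α₀ hα₀ => ?_) (ne2PlusOperator_supOnly_fullG d hLodd hL3 hL ha c35 hc35 ν μ)
  intro x'
  show |(0 : ℝ)| ≤ c35 * j.Msz * α₀
  rw [abs_zero]
  have : (0 : ℝ) ≤ j.Msz := zero_le_one.trans j.one_le_Msz
  positivity

end Summit.QuantumFields.YangMills.BalabanUVNodes.N15.TwoGrid

end
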